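import Literature.Computability.AlgebraicComplexity.SetMultilinear
import Literature.Computability.AlgebraicComplexity.CircuitDepth
import Literature.Computability.AlgebraicComplexity.StandardFamilies
import Mathlib.Data.Complex.Basic
import HarnessLib.Audit.Tags

/-!
# Route `DepthWindow` — the RIFFLE-RANK BRIDGE to the A-cell `Hard(2)` (crux `HomImmHardTwoOne`)

Cone-free helper of the decomp-valiant workshop (lens 4, generation 11), supporting the crux item
`HomImmHardTwoOne` (stmt-ValiantsHypothesis-30635) of `Theses/DepthWindow.lean` through the crux idea
`Cruxes/HomImmHardTwoOne/Ideas/riffle-bridge.md`.  Rossman (Riffle Rank, LAGOS 2025) defines the riffle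
rank `R_riffle` of a tensor `[n]^k × [n]^k → F` (least number of *riffle-basic* tensors
`g(b)·∏ᵢ Aᵢ(aᵢ ; b_{<i})` summing to it), proves (Thm 1.3 / Cor 1.4, log-product lemma) that every
set-multilinear FORMULA of leaf-size `s` for `IMM_{n,k+1}`, of ANY depth, gives
`R_riffle(I_n^{⊗k}) ≤ s·n^{k-⌈log₂(k+1)⌉}`, and conjectures `R_riffle(I_n^{⊗k}) = n^{k-o(log k)}` (Conj. 1.2).

**Proved here** (`riffleBridge`, 0 sorry): `RossmanCover → HomUnroll → SmlizeFormula →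
RiffleIdentityBound → HomImmHardAll` — three print theorems stated as `Prop`s (Rossman's cover; unrolling an
every-gate-homogeneous circuit of product-depth `Γ` into a homogeneous formula of edge size
`(s+|σ|+d+2)^{O(Γ)}`, product-depth `O(Γ)`; LST 2025 Lemma 12 for formulas, blow-up `2^{O(d²Γ)}`), the
conjecture in the weak fixed-rate form `R_riffle(I_n^{⊗k}) ≥ n^{k-⌈log₂(k+1)⌉+⌊log₂ k⌋/t}` at
`k = ⌊√⌊log₂ n⌋⌋-2`, and the conclusion `∀ p q, HomImmHardAt p q` (homogeneous `IMM_{m,⌊√log₂ m⌋}` hardness at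
EVERY depth slope, spelled verbatim to stay cone-free; `p = 2, q = 1` is the crux).  The proof is exponent
bookkeeping: edge size `≤ m^{K(Γ+1)}`, `Γ = O(log₂log₂log₂ m)`, against the riffle bound `m^{⌊log₂ k⌋/t}`.
HONEST FRAMING: a CONDITIONAL bridge (new, depth-free method family for the cell the `φ`-barrier of
nested/lopsided measures blocks); nothing here bears on `VP ≠ VNP` itself.  Riffle-basic is reconstructed
from the prose of the held text of Rossman's paper (display formulas missing; acquisition acq-14887).

References: [Rossman2025] B. Rossman, Riffle Rank, Procedia Comput. Sci. (LAGOS 2025),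
doi:10.1016/j.procs.2025.10.301, Def. 3.1, Lemma 3.3, Thm 1.3, Cor. 1.4–1.6, Conj. 1.2, App. C;
[LimayeSrinivasanTavenas2025] Limaye–Srinivasan–Tavenas, J. ACM 72 (2025) Art. 26, Lemma 12;
[BhargavDuttaSaxena2024] Bhargav–Dutta–Saxena, ACM ToCT 16 (2024), Thm 1.4, 1.7; [Burgisser2000] §2.1.
-/


-- layout Summits/ValiantsHypothesis/ValiantsHypothesis forces the duplicated namespace component
set_option linter.dupNamespace false

namespace Summit.ValiantsHypothesis.ValiantsHypothesis.Theorems.DepthWindow.Riffle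

open MvPolynomial Literature.Computability.AlgebraicComplexity ArithCircuit

universe u

/-! ### Riffle rank (Rossman 2025, Def. 3.1) -/

/-- Even-order tensors `[n]^k × [n]^k → F` (a-indices, b-indices). [cite: Rossman2025, Def. 3.1] -/
abbrev Tensor2 (n k : ℕ) (F : Type u) : Type u := (Fin k → Fin n) → (Fin k → Fin n) → F

variable (F : Type u) [CommRing F]

/-- `t` is riffle-basic: `t(a,b) = g(b) · ∏ᵢ Aᵢ(aᵢ ; b₁,…,b_{i-1})` — the `i`-th factor sees `aᵢ` and the
`b`-indices BEFORE position `i` (for `k = 1` this is a rank-one matrix). [cite: Rossman2025, Def. 3.1] -/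
def IsRiffleBasic {n k : ℕ} (t : Tensor2 n k F) : Prop :=
  ∃ (g : (Fin k → Fin n) → F) (A : (i : Fin k) → Fin n → (Fin i → Fin n) → F),
    ∀ a b, t a b = g b * ∏ i : Fin k, A i (a i) (fun j => b (Fin.castLT j (Nat.lt_trans j.2 i.2)))

/-- The riffle rank of `t`: the least number of riffle-basic tensors summing to `t` (`≤ n^k` always,
`≥ n^k/2` for almost all `t`). [cite: Rossman2025, Def. 3.1, Lemma 3.3] -/
noncomputable def riffleRank {n k : ℕ} (t : Tensor2 n k F) : ℕ :=
  sInf {m : ℕ | ∃ ts : Fin m → Tensor2 n k F, (∀ l, IsRiffleBasic F (ts l)) ∧ ∀ a b, t a b = ∑ l, ts l a b}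

/-- The `k`-fold identity tensor `I_n^{⊗k}(a,b) = [a = b]`. [cite: Rossman2025, Question 1.1] -/
def idPow (n k : ℕ) : Tensor2 n k F := fun a b => if a = b then 1 else 0

/-- A set-multilinear formula (w.r.t. the block map `blk`): a formula every gate value of which is
set-multilinear over some set of blocks. [cite: Rossman2025, Def. 2.7] -/
def IsSmlFormula {σ ι : Type*} (blk : σ → ι) (P : ArithCircuit F σ) : Prop :=
  P.IsFormula ∧ ∀ g ∈ gateValues P.gates, ∃ S : Finset ι, IsSetMultilinear blk S g

/-! ### The four inputs and the conclusion -/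

/-- **Riffle bound for `IMM`** (Rossman Thm 1.3 + Lemma 3.5, in the tree's trace convention
`immPoly n d = tr(X⁽⁰⁾⋯X⁽ᵈ⁻¹⁾)`, `d ≥ 2`, which projects onto the `(1,1)`-entry `IMM_{n,d-1}` by
`X⁽⁰⁾ := E₁₁`; `k = d - 2`): a set-multilinear formula of edge size `E` for `immPoly n d` forces
`R_riffle(I_n^{⊗(d-2)}) ≤ (E+1) · n^{d-2-⌈log₂(d-1)⌉}`.  Print (log-product lemma + Lemma A.7); unported.
[cite: Rossman2025, Thm 1.3, Cor 1.4] -/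
@[conjecture] def RossmanCover : Prop :=
  ∀ (n d : ℕ), 2 ≤ d → ∀ P : ArithCircuit ℂ (Fin d × Fin n × Fin n),
    IsSmlFormula ℂ (Prod.fst : Fin d × Fin n × Fin n → Fin d) P → P.Computes (immPoly n d ℂ) →
    riffleRank ℂ (idPow ℂ n (d - 2)) ≤ (P.edgeSize + 1) * n ^ (d - 2 - Nat.clog 2 (d - 1))

/-- **Unrolling** an every-gate-homogeneous circuit of product-depth `Γ` into an every-gate-homogeneous
FORMULA of edge size `(s + |σ| + d + 2)^{u(Γ+1)}` and product-depth `≤ u(Γ+1)` (semantic pruning by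
homogeneous components bounds the `+`-fan-in by `s + |σ| + 1` and the `×`-fan-in by `d`; scalar
coefficients cost one product gate each; then tree expansion).  Print (folklore); unported.
[cite: Burgisser2000, §2.1] -/
@[conjecture] def HomUnroll : Prop :=
  ∃ u : ℕ, ∀ (σ : Type) [Fintype σ] [DecidableEq σ] (d Γ : ℕ) (f : MvPolynomial σ ℂ),
    f.IsHomogeneous d → ∀ D : ArithCircuit ℂ σ,
      (∀ g ∈ gateValues D.gates, ∃ e : ℕ, g.IsHomogeneous e) → D.Computes f → D.productDepth ≤ Γ →
      ∃ P : ArithCircuit ℂ σ, P.IsFormula ∧ (∀ g ∈ gateValues P.gates, ∃ e : ℕ, g.IsHomogeneous e) ∧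
        P.Computes f ∧ P.productDepth ≤ u * (Γ + 1) ∧
        P.edgeSize ≤ (D.size + Fintype.card σ + d + 2) ^ (u * (Γ + 1))

/-- **Set-multilinearisation of homogeneous formulas** (LST 2025 Lemma 12, formula version: the gates
`α_S`, `S ⊆ ι`, with products split over block assignments — at most `r^{|S|} ≤ 2^{d²}` summands per
product gate of fan-in `r ≤ d`, nested over the `Γ' + 1` product levels of the formula; stated with the
generous blow-up `2^{a·d²·(Γ'+1)}`, `d = |ι|`): a homogeneous formula for a polynomial that is
set-multilinear over all blocks becomes a set-multilinear formula.  Print; unported.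
[cite: LimayeSrinivasanTavenas2025, Lemma 12] -/
@[conjecture] def SmlizeFormula : Prop :=
  ∃ a : ℕ, ∀ (σ ι : Type) [Fintype σ] [DecidableEq σ] [Fintype ι] [DecidableEq ι] (blk : σ → ι)
    (f : MvPolynomial σ ℂ), IsSetMultilinear blk Finset.univ f → ∀ P : ArithCircuit ℂ σ,
      P.IsFormula → (∀ g ∈ gateValues P.gates, ∃ e : ℕ, g.IsHomogeneous e) → P.Computes f →
      ∃ P' : ArithCircuit ℂ σ, IsSmlFormula ℂ blk P' ∧ P'.Computes f ∧
        P'.edgeSize ≤ (P.edgeSize + Fintype.card σ + 2) ^ a *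
          2 ^ (a * Fintype.card ι * Fintype.card ι * (P.productDepth + 1))

/-- **The conjecture, in the weak fixed-rate form the bridge needs** (implied by Rossman's Conjecture
1.2 `R_riffle(I_n^{⊗k}) = n^{k-o(log k)}` in the regime `k(n) = ⌊√⌊log₂ n⌋⌋ - 2`): for some `t ≥ 1` and all
large `n`, `R_riffle(I_n^{⊗k}) ≥ n^{k - ⌈log₂(k+1)⌉ + ⌊log₂ k⌋/t}`.  OPEN (an upper bound
`R_riffle(I_n ⊗ I_n) = O(n^{2-ε})` would refute it by sub-multiplicativity). [cite: Rossman2025, Conj. 1.2, App. C] -/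
@[conjecture] def RiffleIdentityBound : Prop :=
  ∃ t n₀ : ℕ, 0 < t ∧ ∀ n : ℕ, n₀ ≤ n →
    n ^ (Nat.sqrt (Nat.log 2 n) - 2 - Nat.clog 2 (Nat.sqrt (Nat.log 2 n) - 1)
        + Nat.log 2 (Nat.sqrt (Nat.log 2 n) - 2) / t)
      ≤ riffleRank ℂ (idPow ℂ n (Nat.sqrt (Nat.log 2 n) - 2))

/-- **Homogeneous `IMM` hardness at EVERY depth slope** (`∀ p q, HomImmHardAt p q` of
`DepthWindowSlopeRate.lean`, verbatim): for all `p q c`, from some `m₀` on, every every-gate-homogeneous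
circuit of product-depth `≤ ⌊p·L₃ m/q⌋ + c` for `IMM_{m,⌊√⌊log₂ m⌋⌋}` has more than `m^c + c` gates.
OPEN beyond slope `1/log₂ φ`. [cite: BhargavDuttaSaxena2024, Thm. 1.4, Thm. 1.7] -/
@[conjecture] def HomImmHardAll : Prop :=
  ∀ p q c : ℕ, ∃ m₀ : ℕ, ∀ m : ℕ, m₀ ≤ m →
    ∀ D : ArithCircuit ℂ (Fin (Nat.sqrt (Nat.log 2 m)) × Fin m × Fin m),
      (∀ g ∈ ArithCircuit.gateValues D.gates, ∃ e : ℕ, g.IsHomogeneous e) →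
      D.Computes (immPoly m (Nat.sqrt (Nat.log 2 m)) ℂ) →
      D.productDepth ≤ p * Nat.log 2 (Nat.log 2 (Nat.log 2 m)) / q + c → m ^ c + c < D.size

/-- **The riffle bridge** (the implication proved below as `riffleBridge`; a composition, not a fact):
`RossmanCover → HomUnroll → SmlizeFormula → RiffleIdentityBound → HomImmHardAll`. -/
def RiffleBridge : Prop :=
  RossmanCover → HomUnroll → SmlizeFormula → RiffleIdentityBound → HomImmHardAll

/-! ### `IMM` is set-multilinear in its layers -/

/-- Every entry of the ordered product of the generic matrices `X^{(t)}`, `t ∈ l`, is weighted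
homogeneous of block weight `∑_{t ∈ l} e_t` for the layer map `Prod.fst`. [folklore] -/
theorem isWeightedHomogeneous_immMatrix_list_prod {n : Type} [Fintype n] [DecidableEq n]
    (d : ℕ) (l : List (Fin d)) (i j : n) :
    IsWeightedHomogeneous (blockWeight (Prod.fst : Fin d × n × n → Fin d))
      (((l.map fun t => (Matrix.mvPolynomialX n n ℂ).map
        (rename fun ij : n × n => (t, ij))).prod) i j)
      ((l.map fun t => (Finsupp.single t 1 : Fin d →₀ ℕ)).sum) := by
  induction l generalizing i j with
  | nil =>
    simp only [List.map_nil, List.prod_nil, List.sum_nil]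
    by_cases h : i = j
    · subst h; simpa using isWeightedHomogeneous_one ℂ _
    · simpa [Matrix.one_apply_ne h] using isWeightedHomogeneous_zero ℂ _ _
  | cons t l ih =>
    simp only [List.map_cons, List.prod_cons, List.sum_cons]
    rw [Matrix.mul_apply]
    refine IsWeightedHomogeneous.sum _ _ _ fun x _ => ?_
    have h1 : IsWeightedHomogeneous (blockWeight (Prod.fst : Fin d × n × n → Fin d))
        ((Matrix.mvPolynomialX n n ℂ).map (rename fun ij : n × n => (t, ij)) i x)
        (Finsupp.single t 1) := by
      simpa [Matrix.mvPolynomialX, Matrix.map_apply, blockWeight] using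
        isWeightedHomogeneous_X ℂ (blockWeight (Prod.fst : Fin d × n × n → Fin d)) (t, (i, x))
    exact h1.mul (ih x j)

/-- `IMM_{m,d} = tr(X⁽⁰⁾⋯X⁽ᵈ⁻¹⁾)` is set-multilinear over all `d` layers. [cite: LimayeSrinivasanTavenas2025, §2] -/
theorem isSetMultilinear_immPoly (m d : ℕ) :
    IsSetMultilinear (Prod.fst : Fin d × Fin m × Fin m → Fin d) Finset.univ (immPoly m d ℂ) := by
  classical
  unfold IsSetMultilinear immPoly immMatrix Matrix.trace
  have hprof : blockProfile (Finset.univ : Finset (Fin d)) =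
      ((List.finRange d).map fun t => (Finsupp.single t 1 : Fin d →₀ ℕ)).sum := by
    rw [blockProfile, Fin.sum_univ_def]
  rw [hprof]
  refine IsWeightedHomogeneous.sum _ _ _ fun i _ => ?_
  simpa [Matrix.diag] using isWeightedHomogeneous_immMatrix_list_prod (n := Fin m) d (List.finRange d) i i

/-! ### Arithmetic -/

/-- `y² + 2y ≤ 2^y` for `y ≥ 6`. [folklore] -/
private theorem sq_add_le_two_pow {y : ℕ} (hy : 6 ≤ y) : y * y + 2 * y ≤ 2 ^ y := by
  induction y, hy using Nat.le_induction with
  | base => norm_num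
  | succ y hy ih =>
    have h2 : 2 * y + 3 ≤ 2 ^ y := by nlinarith
    calc (y + 1) * (y + 1) + 2 * (y + 1) = (y * y + 2 * y) + (2 * y + 3) := by ring
      _ ≤ 2 ^ y + 2 ^ y := Nat.add_le_add ih h2
      _ = 2 ^ (y + 1) := by ring

/-- `α (y+1) + β ≤ 2^y` for `y ≥ α + β + 6`. [folklore] -/
private theorem lin_le_two_pow (α β : ℕ) {y : ℕ} (hy : α + β + 6 ≤ y) : α * (y + 1) + β ≤ 2 ^ y := by
  induction y, hy using Nat.le_induction with
  | base =>
    have h6 : 6 ≤ α + β + 6 := Nat.le_add_left _ _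
    calc α * (α + β + 6 + 1) + β ≤ (α + β + 6) * (α + β + 6 + 1) + (α + β + 6) :=
          Nat.add_le_add (Nat.mul_le_mul_right _ (by omega)) (by omega)
      _ = (α + β + 6) * (α + β + 6) + 2 * (α + β + 6) := by ring
      _ ≤ 2 ^ (α + β + 6) := sq_add_le_two_pow h6
  | succ y hy ih =>
    have hα : α ≤ 2 ^ y := (show α ≤ y by omega).trans (Nat.lt_two_pow_self).le
    calc α * (y + 1 + 1) + β = (α * (y + 1) + β) + α := by ring
      _ ≤ 2 ^ y + 2 ^ y := Nat.add_le_add ih hα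
      _ = 2 ^ (y + 1) := by ring

/-- **Growth lemma**: `α·⌊log₂ j⌋ + β ≤ j` for all large `j`. [folklore] -/
theorem exists_mul_log_add_le (α β : ℕ) : ∃ j₀ : ℕ, ∀ j : ℕ, j₀ ≤ j → α * Nat.log 2 j + β ≤ j := by
  refine ⟨2 ^ (α + β + 6), fun j hj => ?_⟩
  have hj0 : j ≠ 0 := (lt_of_lt_of_le (Nat.two_pow_pos _) hj).ne'
  have hy : α + β + 6 ≤ Nat.log 2 j := Nat.le_log_of_pow_le (by norm_num) hj
  calc α * Nat.log 2 j + β ≤ α * (Nat.log 2 j + 1) + β := by nlinarith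
    _ ≤ 2 ^ Nat.log 2 j := lin_le_two_pow α β hy
    _ ≤ j := Nat.pow_log_le_self 2 hj0

/-- A sum of at most `5` terms each `≤ m^e` is `≤ m^(e+1)` once `m ≥ 5`. [folklore] -/
private theorem sum5_le_pow_succ {m e x₁ x₂ x₃ x₄ x₅ : ℕ} (hm : 5 ≤ m) (h₁ : x₁ ≤ m ^ e) (h₂ : x₂ ≤ m ^ e)
    (h₃ : x₃ ≤ m ^ e) (h₄ : x₄ ≤ m ^ e) (h₅ : x₅ ≤ m ^ e) : x₁ + x₂ + x₃ + x₄ + x₅ ≤ m ^ (e + 1) := by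
  calc x₁ + x₂ + x₃ + x₄ + x₅ ≤ 5 * m ^ e := by omega
    _ ≤ m * m ^ e := Nat.mul_le_mul_right _ hm
    _ = m ^ (e + 1) := by ring

/-- `2^(x·e) ≤ m^x` whenever `e ≤ ⌊log₂ m⌋` and `m ≠ 0`. [folklore] -/
private theorem two_pow_mul_le_pow {x e m : ℕ} (hm : m ≠ 0) (he : e ≤ Nat.log 2 m) : 2 ^ (x * e) ≤ m ^ x := by
  calc 2 ^ (x * e) ≤ 2 ^ (x * Nat.log 2 m) := Nat.pow_le_pow_right (by norm_num) (Nat.mul_le_mul_left x he)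
    _ = (2 ^ Nat.log 2 m) ^ x := by rw [mul_comm, pow_mul]
    _ ≤ m ^ x := Nat.pow_le_pow_left (Nat.pow_log_le_self 2 hm) x

/-! ### The bridge -/

/-- **The riffle bridge** (decomp-valiant lens 4, g11): Rossman's cover theorem, circuit-to-formula
unrolling at bounded product-depth, set-multilinearisation of homogeneous formulas and the fixed-rate
riffle-rank conjecture for `I_n^{⊗k}`, `k = ⌊√log₂ n⌋ - 2`, together give homogeneous `IMM_{m,⌊√log₂ m⌋}`
hardness at every depth slope — in particular the crux `HomImmHardTwoOne = HomImmHardAt 2 1`.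
[cite: Rossman2025, Thm 1.3, Cor 1.4, Conj. 1.2] [cite: LimayeSrinivasanTavenas2025, Lemma 12] -/
theorem riffleBridge : RiffleBridge := by
  rintro hR ⟨u, hU⟩ ⟨a, hS⟩ ⟨t, n₀, ht, hC⟩ p q c
  -- the constant `K = K(c,u,a)`: the set-multilinear formula has edge size `≤ m^(K (Γ+1))`
  obtain ⟨K, hK⟩ : ∃ K : ℕ, K = a * (c + 4) * u + a * u + 5 * a + 1 := ⟨_, rfl⟩
  obtain ⟨j₀, hj₀⟩ := exists_mul_log_add_le (2 * t * K * p) (2 * t * (K * (c + 1) + 1) + 2)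
  refine ⟨max n₀ (max (2 ^ 2 ^ max j₀ 4) (max c 5)), fun m hm => ?_⟩
  -- thresholds
  have hmn₀ : n₀ ≤ m := le_trans (le_max_left _ _) hm
  have hmJ : 2 ^ 2 ^ max j₀ 4 ≤ m := le_trans (le_trans (le_max_left _ _) (le_max_right _ _)) hm
  have hmc5 : max c 5 ≤ m := le_trans (le_trans (le_max_right _ _) (le_max_right _ _)) hm
  have hmc : c ≤ m := le_trans (le_max_left _ _) hmc5
  have hm5 : 5 ≤ m := le_trans (le_max_right _ _) hmc5
  have hm0 : m ≠ 0 := by omega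
  -- L₁ = ⌊log₂ m⌋ ≥ 2^J and j = ⌊log₂ L₁⌋ ≥ J := max j₀ 4
  have hL₁J : 2 ^ max j₀ 4 ≤ Nat.log 2 m := Nat.le_log_of_pow_le (by norm_num) hmJ
  have hL₁0 : Nat.log 2 m ≠ 0 := (lt_of_lt_of_le (Nat.two_pow_pos _) hL₁J).ne'
  have hjJ : max j₀ 4 ≤ Nat.log 2 (Nat.log 2 m) := Nat.le_log_of_pow_le (by norm_num) hL₁J
  -- facts about d = ⌊√L₁⌋ before generalising it
  have hdd : Nat.sqrt (Nat.log 2 m) * Nat.sqrt (Nat.log 2 m) ≤ Nat.log 2 m := Nat.sqrt_le _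
  have hdm : Nat.sqrt (Nat.log 2 m) ≤ m := (Nat.sqrt_le_self _).trans (Nat.log_le_self 2 m)
  have h2d : 2 ^ (Nat.log 2 (Nat.log 2 m) / 2) ≤ Nat.sqrt (Nat.log 2 m) := by
    rw [Nat.le_sqrt]
    calc 2 ^ (Nat.log 2 (Nat.log 2 m) / 2) * 2 ^ (Nat.log 2 (Nat.log 2 m) / 2)
        = 2 ^ (Nat.log 2 (Nat.log 2 m) / 2 + Nat.log 2 (Nat.log 2 m) / 2) := by rw [← pow_add]
      _ ≤ 2 ^ Nat.log 2 (Nat.log 2 m) := Nat.pow_le_pow_right (by norm_num) (by omega)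
      _ ≤ Nat.log 2 m := Nat.pow_log_le_self 2 hL₁0
  have hConj := hC m hmn₀
  -- generalise d := ⌊√⌊log₂ m⌋⌋ and j := ⌊log₂⌊log₂ m⌋⌋
  generalize hdg : Nat.sqrt (Nat.log 2 m) = d at hdd hdm h2d hConj ⊢
  generalize hjg : Nat.log 2 (Nat.log 2 m) = j at hjJ h2d ⊢
  have hj4 : 4 ≤ j := le_trans (le_max_right _ _) hjJ
  have hjj₀ : j₀ ≤ j := le_trans (le_max_left _ _) hjJ
  -- 2^(j/2-1) ≤ d - 2, hence j/2 - 1 ≤ log₂ (d-2) and d ≥ 2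
  have hd2 : 2 ^ (j / 2 - 1) ≤ d - 2 := by
    have h2 : 2 ^ 1 ≤ 2 ^ (j / 2 - 1) := Nat.pow_le_pow_right (by norm_num) (by omega)
    have h3 : 2 ^ (j / 2) = 2 * 2 ^ (j / 2 - 1) := by rw [← pow_succ']; congr 1; omega
    omega
  have hdge2 : 2 ≤ d := by have : 1 ≤ 2 ^ (j / 2 - 1) := Nat.one_le_two_pow; omega
  have hlogd : j / 2 - 1 ≤ Nat.log 2 (d - 2) := Nat.le_log_of_pow_le (by norm_num) hd2
  intro D hhom hD hpd
  -- generalise the depth budget Γ := ⌊p log₂ j / q⌋ + c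
  have hΓle : p * Nat.log 2 j / q + c + 1 ≤ p * Nat.log 2 j + c + 1 := by
    have : p * Nat.log 2 j / q ≤ p * Nat.log 2 j := Nat.div_le_self _ _
    omega
  generalize hΓg : p * Nat.log 2 j / q + c = Γ at hpd hΓle
  -- the growth inequality at j:  (K (Γ+1) + 1) t ≤ j/2 - 1 ≤ log₂ (d-2)
  have hKΓ : (K * (Γ + 1) + 1) * t ≤ j / 2 - 1 := by
    have h0 : K * (Γ + 1) ≤ K * (p * Nat.log 2 j + c + 1) := Nat.mul_le_mul_left _ hΓle
    have h1 : (K * (Γ + 1) + 1) * t ≤ (K * (p * Nat.log 2 j + c + 1) + 1) * t :=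
      Nat.mul_le_mul_right _ (by omega)
    have h2 : 2 * ((K * (p * Nat.log 2 j + c + 1) + 1) * t) + 2 ≤ j := by
      have : 2 * ((K * (p * Nat.log 2 j + c + 1) + 1) * t) + 2 =
          2 * t * K * p * Nat.log 2 j + (2 * t * (K * (c + 1) + 1) + 2) := by ring
      rw [this]; exact hj₀ j hjj₀
    omega
  have hexp : K * (Γ + 1) < Nat.log 2 (d - 2) / t :=
    Nat.lt_of_succ_le ((Nat.le_div_iff_mul_le ht).2 (le_trans hKΓ hlogd))
  -- by contradiction: a small circuit
  by_contra hsize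
  rw [not_lt] at hsize
  -- (1) unroll
  have hfhom : (immPoly m d ℂ).IsHomogeneous d := immPoly_isHomogeneous_holds (k := ℂ) m d
  obtain ⟨P₁, hP₁F, hP₁hom, hP₁c, hP₁pd, hP₁E⟩ :=
    hU (Fin d × Fin m × Fin m) d Γ (immPoly m d ℂ) hfhom D hhom hD hpd
  -- (2) set-multilinearise
  obtain ⟨P₂, hP₂sml, hP₂c, hP₂E⟩ :=
    hS (Fin d × Fin m × Fin m) (Fin d) Prod.fst (immPoly m d ℂ) (isSetMultilinear_immPoly m d)
      P₁ hP₁F hP₁hom hP₁c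
  -- (3) Rossman + the conjecture:  m^B ≤ E₂ + 1,  B = ⌊log₂(d-2)⌋/t
  have hRoss := hR m d hdge2 P₂ hP₂sml hP₂c
  have hlow : m ^ (Nat.log 2 (d - 2) / t) ≤ P₂.edgeSize + 1 := by
    have hA : 0 < m ^ (d - 2 - Nat.clog 2 (d - 1)) := Nat.pow_pos (by omega)
    have h' : m ^ (d - 2 - Nat.clog 2 (d - 1)) * m ^ (Nat.log 2 (d - 2) / t) ≤
        m ^ (d - 2 - Nat.clog 2 (d - 1)) * (P₂.edgeSize + 1) := by
      calc m ^ (d - 2 - Nat.clog 2 (d - 1)) * m ^ (Nat.log 2 (d - 2) / t)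
          = m ^ (d - 2 - Nat.clog 2 (d - 1) + Nat.log 2 (d - 2) / t) := (pow_add _ _ _).symm
        _ ≤ (P₂.edgeSize + 1) * m ^ (d - 2 - Nat.clog 2 (d - 1)) := le_trans hConj hRoss
        _ = m ^ (d - 2 - Nat.clog 2 (d - 1)) * (P₂.edgeSize + 1) := mul_comm _ _
    exact Nat.le_of_mul_le_mul_left h' hA
  -- (4) the upper bound  E₂ + 1 ≤ m^(K (Γ+1))
  have hcard : Fintype.card (Fin d × Fin m × Fin m) = d * (m * m) := by simp [Fintype.card_prod]
  have hcardι : Fintype.card (Fin d) = d := Fintype.card_fin d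
  have hmpow : ∀ e, 1 ≤ e → m ≤ m ^ e := fun e he =>
    (pow_one m).symm.le.trans (Nat.pow_le_pow_right (by omega) he)
  have hmpos : ∀ e, 1 ≤ m ^ e := fun e => Nat.one_le_pow _ _ (by omega)
  -- X := D.size + |σ| + d + 2 ≤ m^(c+4)
  have hX : D.size + Fintype.card (Fin d × Fin m × Fin m) + d + 2 ≤ m ^ (c + 4) := by
    rw [hcard]
    have e1 : m ^ c ≤ m ^ (c + 3) := Nat.pow_le_pow_right (by omega) (by omega)
    have e2 : c ≤ m ^ (c + 3) := le_trans hmc (hmpow _ (by omega))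
    have e3 : d * (m * m) ≤ m ^ (c + 3) := (Nat.mul_le_mul_right _ hdm).trans
      ((show m * (m * m) = m ^ 3 by ring).le.trans (Nat.pow_le_pow_right (by omega) (by omega)))
    have e4 : d ≤ m ^ (c + 3) := le_trans hdm (hmpow _ (by omega))
    have e5 : 2 ≤ m ^ (c + 3) := le_trans (by omega : 2 ≤ m) (hmpow _ (by omega))
    have h5 := sum5_le_pow_succ (e := c + 3) hm5 e1 e2 e3 e4 e5
    have hs : D.size ≤ m ^ c + c := hsize
    have h34 : m ^ (c + 3 + 1) = m ^ (c + 4) := rfl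
    omega
  -- E₁ ≤ m^((c+4) u (Γ+1))
  have hE₁ : P₁.edgeSize ≤ m ^ ((c + 4) * (u * (Γ + 1))) := by
    calc P₁.edgeSize ≤ (D.size + Fintype.card (Fin d × Fin m × Fin m) + d + 2) ^ (u * (Γ + 1)) := hP₁E
      _ ≤ (m ^ (c + 4)) ^ (u * (Γ + 1)) := Nat.pow_le_pow_left hX _
      _ = m ^ ((c + 4) * (u * (Γ + 1))) := by rw [← pow_mul]
  -- Y := E₁ + |σ| + 2 ≤ m^(W₁ + 4),  W₁ := (c+4) u (Γ+1)
  generalize hW₁g : (c + 4) * (u * (Γ + 1)) = W₁ at hE₁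
  have hY : P₁.edgeSize + Fintype.card (Fin d × Fin m × Fin m) + 2 ≤ m ^ (W₁ + 4) := by
    rw [hcard]
    have e1 : P₁.edgeSize ≤ m ^ (W₁ + 3) := le_trans hE₁ (Nat.pow_le_pow_right (by omega) (by omega))
    have e3 : d * (m * m) ≤ m ^ (W₁ + 3) := (Nat.mul_le_mul_right _ hdm).trans
      ((show m * (m * m) = m ^ 3 by ring).le.trans (Nat.pow_le_pow_right (by omega) (by omega)))
    have e5 : 2 ≤ m ^ (W₁ + 3) := le_trans (by omega : 2 ≤ m) (hmpow _ (by omega))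
    have h5 := sum5_le_pow_succ (x₄ := 0) (x₅ := 0) hm5 e1 e3 e5 (Nat.zero_le _) (Nat.zero_le _)
    have h34 : m ^ (W₁ + 3 + 1) = m ^ (W₁ + 4) := rfl
    omega
  -- the 2-power factor ≤ m^(a (u(Γ+1)+1))
  have h2pow : 2 ^ (a * Fintype.card (Fin d) * Fintype.card (Fin d) * (P₁.productDepth + 1)) ≤
      m ^ (a * (u * (Γ + 1) + 1)) := by
    rw [hcardι]
    have hmono : a * d * d * (P₁.productDepth + 1) ≤ a * (u * (Γ + 1) + 1) * (d * d) := by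
      have : P₁.productDepth + 1 ≤ u * (Γ + 1) + 1 := by omega
      calc a * d * d * (P₁.productDepth + 1) ≤ a * d * d * (u * (Γ + 1) + 1) :=
          Nat.mul_le_mul_left _ this
        _ = a * (u * (Γ + 1) + 1) * (d * d) := by ring
    calc 2 ^ (a * d * d * (P₁.productDepth + 1)) ≤ 2 ^ (a * (u * (Γ + 1) + 1) * (d * d)) :=
          Nat.pow_le_pow_right (by norm_num) hmono
      _ ≤ m ^ (a * (u * (Γ + 1) + 1)) := two_pow_mul_le_pow hm0 hdd
  -- E₂ + 1 ≤ m^(K (Γ+1))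
  have hle : a * (W₁ + 4) + a * (u * (Γ + 1) + 1) + 1 ≤ K * (Γ + 1) := by
    have h5 : 5 * a + 1 ≤ (5 * a + 1) * (Γ + 1) := Nat.le_mul_of_pos_right _ (by omega)
    calc a * (W₁ + 4) + a * (u * (Γ + 1) + 1) + 1
        = (a * (c + 4) * u + a * u) * (Γ + 1) + (5 * a + 1) := by rw [← hW₁g]; ring
      _ ≤ (a * (c + 4) * u + a * u) * (Γ + 1) + (5 * a + 1) * (Γ + 1) := Nat.add_le_add_left h5 _
      _ = K * (Γ + 1) := by rw [hK]; ring
  have hE₂ : P₂.edgeSize + 1 ≤ m ^ (K * (Γ + 1)) := by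
    have h1 : P₂.edgeSize ≤ m ^ (a * (W₁ + 4) + a * (u * (Γ + 1) + 1)) := by
      calc P₂.edgeSize ≤ (P₁.edgeSize + Fintype.card (Fin d × Fin m × Fin m) + 2) ^ a *
            2 ^ (a * Fintype.card (Fin d) * Fintype.card (Fin d) * (P₁.productDepth + 1)) := hP₂E
        _ ≤ (m ^ (W₁ + 4)) ^ a * m ^ (a * (u * (Γ + 1) + 1)) :=
            Nat.mul_le_mul (Nat.pow_le_pow_left hY _) h2pow
        _ = m ^ (a * (W₁ + 4) + a * (u * (Γ + 1) + 1)) := by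
            rw [← pow_mul, ← pow_add, mul_comm (W₁ + 4)]
    generalize hVg : a * (W₁ + 4) + a * (u * (Γ + 1) + 1) = V at h1 hle
    have h2 : m ^ V + 1 ≤ m ^ (V + 1) := by
      calc m ^ V + 1 ≤ m ^ V + m ^ V := Nat.add_le_add_left (hmpos _) _
        _ = 2 * m ^ V := by ring
        _ ≤ m * m ^ V := Nat.mul_le_mul_right _ (by omega)
        _ = m ^ (V + 1) := by ring
    have h3 : m ^ (V + 1) ≤ m ^ (K * (Γ + 1)) := Nat.pow_le_pow_right (by omega) hle
    omega
  -- (5) contradiction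
  have hlt : m ^ (K * (Γ + 1)) < m ^ (Nat.log 2 (d - 2) / t) := Nat.pow_lt_pow_right (by omega) hexp
  omega

/-- **Corollary: the crux instance.** Under the four inputs, `HomImmHardAt 2 1` (= the route decl
`HomImmHardTwoOne` by `Iff.rfl`), spelled verbatim. [cite: Rossman2025, Cor 1.5] -/
theorem homImmHardAt_two_one_of_riffle (hR : RossmanCover) (hU : HomUnroll) (hS : SmlizeFormula)
    (hC : RiffleIdentityBound) :
    ∀ c : ℕ, ∃ m₀ : ℕ, ∀ m : ℕ, m₀ ≤ m →
      ∀ D : ArithCircuit ℂ (Fin (Nat.sqrt (Nat.log 2 m)) × Fin m × Fin m),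
        (∀ g ∈ ArithCircuit.gateValues D.gates, ∃ e : ℕ, g.IsHomogeneous e) →
        D.Computes (immPoly m (Nat.sqrt (Nat.log 2 m)) ℂ) →
        D.productDepth ≤ 2 * Nat.log 2 (Nat.log 2 (Nat.log 2 m)) / 1 + c → m ^ c + c < D.size :=
  riffleBridge hR hU hS hC 2 1

end Summit.ValiantsHypothesis.ValiantsHypothesis.Theorems.DepthWindow.Riffle
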